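import Summits.Ventures.Crystal3D.Theorems.StickyWulffConstantTextureLiminfLineCountGlueUpApart
import Summits.Ventures.Crystal3D.Theorems.StickyWulffConstantTextureLiminfLaySlabVariation
import HarnessLib

/-!
# `T1_adj`: the two-family chosen-step wall-cell glue with ADJACENT-MEAN flux domination (flux-sliver lemma L2 of cf-p1 (cciv))
# (lane T, crux `TextureLiminfV5`, stmt-Ventures-23912, sub-crux EDGE-ON, class `FluxPairFailAt`; cf-p1 (cci)(i)/(cciv) L2, 19480-p2 g13;
#  inputs: wulff-p2's `…LineCountGlueUpApart` (T1 of (ε₂)) and 19480-p1's `…LaySlabVariation` (L1, p713366))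

HONEST FRAMING. Venture `Summits/Ventures/Crystal3D` (cell `crystal3d-full`), route `route-Ventures-StickyWulffConstant`, helper
`--supports` the law-v5 crux `TextureLiminfV5` (stmt-Ventures-23912).  Bookkeeping only (tsum algebra + one numeric constant), standard axioms;
nothing about any wall law is claimed beyond the stated implications; rung F-C1 not moved.

WHAT.  `two_charge_le_lines_inner_up₂` (…LineCountGlueUpApart) consumes a table dominated by half the two-sided flux sum of the SAME bilayer pair,
`c i j ≤ √2·(r₁ i + r₂ j)/2`, `r₁ i = ⟪step₁ i, L₁⁻¹e₃⟫`, `r₂ j = ⟪step₂ j, L₂⁻¹(−e₃)⟫`.  The ADJACENT-MEAN line of record for the flux sliver (cf-p1 (cciv),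
19480-p1 ALPHA-ANSWER.md §3, 19480-p2 critique (cci)(i)) charges instead against the means `r̃₁ i = ½(r₁ i + r₁ (i+1))`, `r̃₂ j = ½(r₂ j + r₂ (j+1))` — on a
`(∇,Δ)` junction `½(capper + slot) ≥ √3/4` where the capper alone may be `1/(2√3)`.  This is legitimate up to the total variation of the strip volumes,
`Σ_i ½(r_i + r_{i+1})·v_i ≤ Σ_i r_i·v_i + (R/2)·4πρ·hB/ℓ` (`tsum_adjMean_mul_volume_le`, `ℓ = √((L e₃)₀² + (L e₃)₁²) = sin β`), which is `O(ρ)` only on a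
class with `sin β` bounded below — so the cell carries the class parameter `ℓ₀ ≤ sin βᵢ` and a constant `∝ 1/ℓ₀`:
* `two_charge_le_lines_inner_up₂_adj` — `2Q(wallSlice ρ') ≤ #T₁ + #T₂ + (√2/2)·4πρ'·hB·(1/ℓ₁ + 1/ℓ₂)`;
* `cell_charge_le_lines_margin_up₂_adj` — `2Q(wallSlice ρ) ≤ #T₁ + #T₂ + 80(R₀+9)(1+h)ρ + 18mρ + (√2/2)·4πρ·hB·(1/ℓ₁ + 1/ℓ₂)`;
* `two_sqrt_two_pi_hB_le` — `2√2·π·hB ≤ 15/2` (so the penalty is `≤ 15ρ/ℓ₀`);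
* **`bilayerWallAt_of_lineCount_up₂_adj`** — the G3 deliverable shape (verbatim the `hF` of `bilayerWallAt_of_lineCount_up₂`) with the adjacent-mean table
  domination and `0 < ℓ₀ ≤ sin β₁, sin β₂` ⇒ `BilayerWallAt ((C_w + 80(R₀+9) + 15/ℓ₀ + 3456 + 1152(R₀+1))/2) R₀ σ₁ σ₂ L₁ L₂ s₁ s₂ c`.
WHAT THIS IS NOT: no certificate (which pairs admit an adjacent-mean-dominated table at `13/25` is 19480-p1's STEEP-PLATE/ALPHA-ANSWER geometry and the
L4 tilt lemma); no same-plate row family (L3 withdrawn-as-stated, L3-OBJECTION.md); not `fluxPairFailAt_pays`; F-C1 not moved.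
-/

noncomputable section

namespace Summit.Ventures.Crystal3D.Theorems

open MeasureTheory Set
open scoped ENNReal InnerProductSpace
open Literature.MathematicalPhysics.StatisticalMechanics (IsHaggSeq triangularVec₁ triangularVec₂ fccStacking)
open Summit.Ventures.Crystal3D.Cruxes.TextureLiminf.TexShadow (E3 e₃ cyl stacking laySlab bilayerRise BilayerWallAt)
open Summit.Ventures.Crystal3D.TentCertificate (hB hB_pos hB_sq)

/-! ## The adjacent-mean flux count of ONE plate -/

/-- **Adjacent-mean flux count of one up-presented plate** (`plate_lines_ge_flux_up` + `tsum_adjMean_mul_volume_le`): with `rᵢ = ⟪step i, L⁻¹e⟫ ∈ [1/4, 1]`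
and the unit wall slice `wallSlice ρ'` inside the window `{z₁ ≤ ⟪·,e⟫ ≤ z₁ + 1}`,
`Σ_i √2·½(r_i + r_{i+1})·|wallSlice ρ' ∩ laySlab_i| ≤ #T + (√2/2)·4πρ'·hB/ℓ`, `ℓ = √((L e₃)₀² + (L e₃)₁²)`. -/
theorem plate_lines_ge_flux_up_adj {σ : ℤ → ℤ} (hσ : IsHaggSeq σ) (L : E3 ≃ₗᵢ[ℝ] E3) (s e : E3) (he : ‖e‖ = 1)
    (hax : 0 ≤ (L.symm e) 2) {step : ℤ → E3} (hup : ∀ k : ℤ, IsUpBond L σ e k (step k))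
    (hr : ∀ k : ℤ, (1 / 4 : ℝ) ≤ ⟪step k, L.symm e⟫_ℝ) (hℓ : 0 < (L e₃) 0 ^ 2 + (L e₃) 1 ^ 2)
    (ρ' z₁ H : ℝ) (hρ' : 0 ≤ ρ') (hH : H + 1 ≤ z₁ - 3)
    (hS : wallSlice ρ' ⊆ {p : E3 | z₁ ≤ ⟪p, e⟫_ℝ ∧ ⟪p, e⟫_ℝ ≤ z₁ + 1 ∧ Real.sqrt (p 0 ^ 2 + p 1 ^ 2) ≤ ρ'})
    (T : Finset (Fin 2 → ℤ))
    (hT : ∀ t : Fin 2 → ℤ, (∃ k : ℤ,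
        H ≤ ⟪L (zigVertexS step k + ((t 0 : ℝ) • triangularVec₁ 1 + (t 1 : ℝ) • triangularVec₂ 1)) + s, e⟫_ℝ ∧
        ⟪L (zigVertexS step k + ((t 0 : ℝ) • triangularVec₁ 1 + (t 1 : ℝ) • triangularVec₂ 1)) + s, e⟫_ℝ ≤ H + 1 ∧
        Real.sqrt ((L (zigVertexS step k + ((t 0 : ℝ) • triangularVec₁ 1 + (t 1 : ℝ) • triangularVec₂ 1)) + s) 0 ^ 2 +
          (L (zigVertexS step k + ((t 0 : ℝ) • triangularVec₁ 1 + (t 1 : ℝ) • triangularVec₂ 1)) + s) 1 ^ 2) ≤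
          ρ' + 4 + 4 * (z₁ + 4 - H)) → t ∈ T) :
    ∑' i : ℤ, (Real.sqrt 2 * ((⟪step i, L.symm e⟫_ℝ + ⟪step (i + 1), L.symm e⟫_ℝ) / 2)) *
        (volume (wallSlice ρ' ∩ laySlab L s i)).toReal ≤
      (T.card : ℝ) + Real.sqrt 2 / 2 * (4 * Real.pi * ρ' * (hB / Real.sqrt ((L e₃) 0 ^ 2 + (L e₃) 1 ^ 2))) := by
  have hs2 : 0 ≤ Real.sqrt 2 := Real.sqrt_nonneg 2
  have hSfin : volume (wallSlice ρ') ≠ ⊤ := by rw [volume_wallSlice ρ' hρ']; exact ENNReal.ofReal_ne_top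
  have hr0 : ∀ i, 0 ≤ ⟪step i, L.symm e⟫_ℝ := fun i => le_trans (by norm_num) (hr i)
  have hr1 : ∀ i, ⟪step i, L.symm e⟫_ℝ ≤ 1 := fun i =>
    (real_inner_le_norm _ _).trans (by rw [(hup i).norm_eq_one, LinearIsometryEquiv.norm_map, he, one_mul])
  -- the exact flux count
  have hP := plate_lines_ge_flux_up hσ L s e he hax hup hr ρ' z₁ H hH (wallSlice ρ') (measurableSet_wallSlice ρ') hSfin hS T hT
  -- the adjacent-mean correction
  obtain ⟨-, -, hadj⟩ := tsum_adjMean_mul_volume_le L s hρ' hℓ (r := fun i => ⟪step i, L.symm e⟫_ℝ) (R := 1) hr0 hr1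
  have hrew : ∀ i : ℤ, (Real.sqrt 2 * ((⟪step i, L.symm e⟫_ℝ + ⟪step (i + 1), L.symm e⟫_ℝ) / 2)) *
        (volume (wallSlice ρ' ∩ laySlab L s i)).toReal =
      Real.sqrt 2 * (((⟪step i, L.symm e⟫_ℝ + ⟪step (i + 1), L.symm e⟫_ℝ) / 2) * (volume (wallSlice ρ' ∩ laySlab L s i)).toReal) :=
    fun i => by ring
  have hrew' : ∀ i : ℤ, (Real.sqrt 2 * ⟪step i, L.symm e⟫_ℝ) * (volume (wallSlice ρ' ∩ laySlab L s i)).toReal =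
      Real.sqrt 2 * (⟪step i, L.symm e⟫_ℝ * (volume (wallSlice ρ' ∩ laySlab L s i)).toReal) := fun i => by ring
  rw [tsum_congr hrew, tsum_mul_left]
  rw [tsum_congr hrew', tsum_mul_left] at hP
  have h1 := mul_le_mul_of_nonneg_left hadj hs2
  have h2 : Real.sqrt 2 * (∑' i : ℤ, ⟪step i, L.symm e⟫_ℝ * (volume (wallSlice ρ' ∩ laySlab L s i)).toReal +
      1 / 2 * (4 * Real.pi * ρ' * (hB / Real.sqrt ((L e₃) 0 ^ 2 + (L e₃) 1 ^ 2)))) =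
      Real.sqrt 2 * ∑' i : ℤ, ⟪step i, L.symm e⟫_ℝ * (volume (wallSlice ρ' ∩ laySlab L s i)).toReal +
        Real.sqrt 2 / 2 * (4 * Real.pi * ρ' * (hB / Real.sqrt ((L e₃) 0 ^ 2 + (L e₃) 1 ^ 2))) := by ring
  linarith

/-! ## The inner two-family flux count with adjacent-mean domination -/

/-- **Inner TWO-family flux count, chosen steps, ADJACENT-MEAN domination** (`T1_adj`, inner form).  As `two_charge_le_lines_inner_up₂` but the table is
dominated by half the two-sided sum of the adjacent MEANS, `c i j ≤ √2·(½(r₁ i + r₁ (i+1)) + ½(r₂ j + r₂ (j+1)))/2`, both plates tilted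
(`0 < (Lᵢ e₃)₀² + (Lᵢ e₃)₁²`); the strip-volume variation costs `(√2/2)·4πρ'·hB·(1/ℓ₁ + 1/ℓ₂)`. -/
theorem two_charge_le_lines_inner_up₂_adj {σ₁ σ₂ : ℤ → ℤ} (hσ₁ : IsHaggSeq σ₁) (hσ₂ : IsHaggSeq σ₂)
    (L₁ L₂ : E3 ≃ₗᵢ[ℝ] E3) (s₁ s₂ : E3) (R₀ h ρ' : ℝ) (hR₀ : 1 ≤ R₀) (hh : 0 ≤ h) (hρ' : 0 ≤ ρ')
    (hax₁ : 0 ≤ (L₁.symm e₃) 2) (hax₂ : 0 ≤ (L₂.symm (-e₃)) 2)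
    (hℓ₁ : 0 < (L₁ e₃) 0 ^ 2 + (L₁ e₃) 1 ^ 2) (hℓ₂ : 0 < (L₂ e₃) 0 ^ 2 + (L₂ e₃) 1 ^ 2)
    {step₁ : ℤ → E3} (hup₁ : ∀ k : ℤ, IsUpBond L₁ σ₁ e₃ k (step₁ k)) (hr₁ : ∀ k : ℤ, (1 / 4 : ℝ) ≤ ⟪step₁ k, L₁.symm e₃⟫_ℝ)
    {step₂ : ℤ → E3} (hup₂ : ∀ k : ℤ, IsUpBond L₂ σ₂ (-e₃) k (step₂ k)) (hr₂ : ∀ k : ℤ, (1 / 4 : ℝ) ≤ ⟪step₂ k, L₂.symm (-e₃)⟫_ℝ)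
    (c : ℤ → ℤ → ℝ) (hc0 : ∀ i j, 0 ≤ c i j)
    (hdom : ∀ i j, c i j ≤ Real.sqrt 2 * ((⟪step₁ i, L₁.symm e₃⟫_ℝ + ⟪step₁ (i + 1), L₁.symm e₃⟫_ℝ) / 2 +
      (⟪step₂ j, L₂.symm (-e₃)⟫_ℝ + ⟪step₂ (j + 1), L₂.symm (-e₃)⟫_ℝ) / 2) / 2)
    (T₁ T₂ : Finset (Fin 2 → ℤ))
    (hT₁ : ∀ t : Fin 2 → ℤ, (∃ k : ℤ,
        -R₀ - 4 ≤ (L₁ (zigVertexS step₁ k + ((t 0 : ℝ) • triangularVec₁ 1 + (t 1 : ℝ) • triangularVec₂ 1)) + s₁) 2 ∧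
        (L₁ (zigVertexS step₁ k + ((t 0 : ℝ) • triangularVec₁ 1 + (t 1 : ℝ) • triangularVec₂ 1)) + s₁) 2 ≤ -R₀ - 3 ∧
        Real.sqrt ((L₁ (zigVertexS step₁ k + ((t 0 : ℝ) • triangularVec₁ 1 + (t 1 : ℝ) • triangularVec₂ 1)) + s₁) 0 ^ 2 +
          (L₁ (zigVertexS step₁ k + ((t 0 : ℝ) • triangularVec₁ 1 + (t 1 : ℝ) • triangularVec₂ 1)) + s₁) 1 ^ 2) ≤
          ρ' + 4 * R₀ + 36) → t ∈ T₁)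
    (hT₂ : ∀ t : Fin 2 → ℤ, (∃ k : ℤ,
        h + R₀ + 3 ≤ (L₂ (zigVertexS step₂ k + ((t 0 : ℝ) • triangularVec₁ 1 + (t 1 : ℝ) • triangularVec₂ 1)) + s₂) 2 ∧
        (L₂ (zigVertexS step₂ k + ((t 0 : ℝ) • triangularVec₁ 1 + (t 1 : ℝ) • triangularVec₂ 1)) + s₂) 2 ≤ h + R₀ + 4 ∧
        Real.sqrt ((L₂ (zigVertexS step₂ k + ((t 0 : ℝ) • triangularVec₁ 1 + (t 1 : ℝ) • triangularVec₂ 1)) + s₂) 0 ^ 2 +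
          (L₂ (zigVertexS step₂ k + ((t 0 : ℝ) • triangularVec₁ 1 + (t 1 : ℝ) • triangularVec₂ 1)) + s₂) 1 ^ 2) ≤
          ρ' + 4 * h + 4 * R₀ + 36) → t ∈ T₂) :
    2 * ∑' ij : ℤ × ℤ, c ij.1 ij.2 * (volume (wallSlice ρ' ∩ laySlab L₁ s₁ ij.1 ∩ laySlab L₂ s₂ ij.2)).toReal ≤
      (T₁.card : ℝ) + T₂.card +
        (Real.sqrt 2 / 2 * (4 * Real.pi * ρ' * (hB / Real.sqrt ((L₁ e₃) 0 ^ 2 + (L₁ e₃) 1 ^ 2))) +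
          Real.sqrt 2 / 2 * (4 * Real.pi * ρ' * (hB / Real.sqrt ((L₂ e₃) 0 ^ 2 + (L₂ e₃) 1 ^ 2)))) := by
  have he₃ : ‖(e₃ : E3)‖ = 1 := by rw [e₃, PiLp.norm_single, norm_one]
  have hne₃ : ‖(-e₃ : E3)‖ = 1 := by rw [norm_neg, he₃]
  have hi₃ : ∀ p : E3, ⟪p, e₃⟫_ℝ = p 2 := fun p => by
    rw [e₃, EuclideanSpace.inner_single_right]; simp
  have hs2 : 0 ≤ Real.sqrt 2 := Real.sqrt_nonneg 2
  have hSfin : volume (wallSlice ρ') ≠ ⊤ := by rw [volume_wallSlice ρ' hρ']; exact ENNReal.ofReal_ne_top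
  have hr₁0 : ∀ i, 0 ≤ ⟪step₁ i, L₁.symm e₃⟫_ℝ := fun i => le_trans (by norm_num) (hr₁ i)
  have hr₁1 : ∀ i, ⟪step₁ i, L₁.symm e₃⟫_ℝ ≤ 1 := fun i =>
    (real_inner_le_norm _ _).trans (by rw [(hup₁ i).norm_eq_one, LinearIsometryEquiv.norm_map, he₃, one_mul])
  have hr₂0 : ∀ j, 0 ≤ ⟪step₂ j, L₂.symm (-e₃)⟫_ℝ := fun j => le_trans (by norm_num) (hr₂ j)
  have hr₂1 : ∀ j, ⟪step₂ j, L₂.symm (-e₃)⟫_ℝ ≤ 1 := fun j =>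
    (real_inner_le_norm _ _).trans (by rw [(hup₂ j).norm_eq_one, LinearIsometryEquiv.norm_map, hne₃, one_mul])
  -- the mean fluxes
  set κ₁ : ℤ → ℝ := fun i => Real.sqrt 2 * ((⟪step₁ i, L₁.symm e₃⟫_ℝ + ⟪step₁ (i + 1), L₁.symm e₃⟫_ℝ) / 2) with hκ₁
  set κ₂ : ℤ → ℝ := fun j => Real.sqrt 2 * ((⟪step₂ j, L₂.symm (-e₃)⟫_ℝ + ⟪step₂ (j + 1), L₂.symm (-e₃)⟫_ℝ) / 2) with hκ₂
  have hκ₁0 : ∀ i, 0 ≤ κ₁ i := fun i => mul_nonneg hs2 (by linarith [hr₁0 i, hr₁0 (i + 1)])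
  have hκ₁B : ∀ i, κ₁ i ≤ Real.sqrt 2 := fun i => mul_le_of_le_one_right hs2 (by linarith [hr₁1 i, hr₁1 (i + 1)])
  have hκ₂0 : ∀ j, 0 ≤ κ₂ j := fun j => mul_nonneg hs2 (by linarith [hr₂0 j, hr₂0 (j + 1)])
  have hκ₂B : ∀ j, κ₂ j ≤ Real.sqrt 2 := fun j => mul_le_of_le_one_right hs2 (by linarith [hr₂1 j, hr₂1 (j + 1)])
  have hdomκ : ∀ i j, c i j ≤ (κ₁ i + κ₂ j) / 2 := fun i j => by
    have := hdom i j
    simp only [hκ₁, hκ₂]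
    linarith
  have hflux := charge_le_flux L₁ L₂ s₁ s₂ κ₁ κ₂ c (Real.sqrt 2) hκ₁0 hκ₁B hκ₂0 hκ₂B hc0 hdomκ (wallSlice ρ')
    (measurableSet_wallSlice ρ') hSfin
  -- plate 1
  have hsub₁ : wallSlice ρ' ⊆ {p : E3 | (0 : ℝ) ≤ ⟪p, e₃⟫_ℝ ∧ ⟪p, e₃⟫_ℝ ≤ 0 + 1 ∧ Real.sqrt (p 0 ^ 2 + p 1 ^ 2) ≤ ρ'} := by
    rintro p ⟨h1, h2, h3⟩
    refine ⟨by rw [hi₃]; exact h1, by rw [hi₃]; linarith, ?_⟩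
    rw [← Real.sqrt_sq hρ']; exact Real.sqrt_le_sqrt h3
  have hP₁ := plate_lines_ge_flux_up_adj hσ₁ L₁ s₁ e₃ he₃ hax₁ hup₁ hr₁ hℓ₁ ρ' 0 (-R₀ - 4) hρ' (by linarith) hsub₁ T₁
    (fun t ⟨k, hk1, hk2, hk3⟩ => hT₁ t ⟨k, by rw [hi₃] at hk1; linarith, by rw [hi₃] at hk2; linarith,
      hk3.trans (by linarith)⟩)
  -- plate 2
  have hsub₂ : wallSlice ρ' ⊆ {p : E3 | (-1 : ℝ) ≤ ⟪p, -e₃⟫_ℝ ∧ ⟪p, -e₃⟫_ℝ ≤ -1 + 1 ∧ Real.sqrt (p 0 ^ 2 + p 1 ^ 2) ≤ ρ'} := by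
    rintro p ⟨h1, h2, h3⟩
    refine ⟨by rw [inner_neg_right, hi₃]; linarith, by rw [inner_neg_right, hi₃]; linarith, ?_⟩
    rw [← Real.sqrt_sq hρ']; exact Real.sqrt_le_sqrt h3
  have hP₂ := plate_lines_ge_flux_up_adj hσ₂ L₂ s₂ (-e₃) hne₃ hax₂ hup₂ hr₂ hℓ₂ ρ' (-1) (-h - R₀ - 4) hρ' (by linarith) hsub₂ T₂
    (fun t ⟨k, hk1, hk2, hk3⟩ => hT₂ t ⟨k, by rw [inner_neg_right, hi₃] at hk2; linarith,
      by rw [inner_neg_right, hi₃] at hk1; linarith, hk3.trans (by linarith)⟩)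
  have hP₁' : ∑' i : ℤ, κ₁ i * (volume (wallSlice ρ' ∩ laySlab L₁ s₁ i)).toReal ≤
      (T₁.card : ℝ) + Real.sqrt 2 / 2 * (4 * Real.pi * ρ' * (hB / Real.sqrt ((L₁ e₃) 0 ^ 2 + (L₁ e₃) 1 ^ 2))) := hP₁
  have hP₂' : ∑' j : ℤ, κ₂ j * (volume (wallSlice ρ' ∩ laySlab L₂ s₂ j)).toReal ≤
      (T₂.card : ℝ) + Real.sqrt 2 / 2 * (4 * Real.pi * ρ' * (hB / Real.sqrt ((L₂ e₃) 0 ^ 2 + (L₂ e₃) 1 ^ 2))) := hP₂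
  linarith

/-! ## The cell form: rim + margin + strip-variation penalty -/

/-- **Two-family cell bound along chosen steps, adjacent-mean domination, with margin**:
`2Q(wallSlice ρ) ≤ #T₁ + #T₂ + 80(R₀+9)(1+h)ρ + 18mρ + (√2/2)·4πρ·hB·(1/ℓ₁ + 1/ℓ₂)`. -/
theorem cell_charge_le_lines_margin_up₂_adj {σ₁ σ₂ : ℤ → ℤ} (hσ₁ : IsHaggSeq σ₁) (hσ₂ : IsHaggSeq σ₂)
    (L₁ L₂ : E3 ≃ₗᵢ[ℝ] E3) (s₁ s₂ : E3) (R₀ h ρ : ℝ) (hR₀ : 1 ≤ R₀) (hh : 0 ≤ h) (hρ : 0 ≤ ρ)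
    (hax₁ : 0 ≤ (L₁.symm e₃) 2) (hax₂ : 0 ≤ (L₂.symm (-e₃)) 2)
    (hℓ₁ : 0 < (L₁ e₃) 0 ^ 2 + (L₁ e₃) 1 ^ 2) (hℓ₂ : 0 < (L₂ e₃) 0 ^ 2 + (L₂ e₃) 1 ^ 2)
    {step₁ : ℤ → E3} (hup₁ : ∀ k : ℤ, IsUpBond L₁ σ₁ e₃ k (step₁ k)) (hr₁ : ∀ k : ℤ, (1 / 4 : ℝ) ≤ ⟪step₁ k, L₁.symm e₃⟫_ℝ)
    {step₂ : ℤ → E3} (hup₂ : ∀ k : ℤ, IsUpBond L₂ σ₂ (-e₃) k (step₂ k)) (hr₂ : ∀ k : ℤ, (1 / 4 : ℝ) ≤ ⟪step₂ k, L₂.symm (-e₃)⟫_ℝ)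
    (c : ℤ → ℤ → ℝ) (hc0 : ∀ i j, 0 ≤ c i j)
    (hdom : ∀ i j, c i j ≤ Real.sqrt 2 * ((⟪step₁ i, L₁.symm e₃⟫_ℝ + ⟪step₁ (i + 1), L₁.symm e₃⟫_ℝ) / 2 +
      (⟪step₂ j, L₂.symm (-e₃)⟫_ℝ + ⟪step₂ (j + 1), L₂.symm (-e₃)⟫_ℝ) / 2) / 2)
    (m : ℝ) (hm : 0 ≤ m) (T₁ T₂ : Finset (Fin 2 → ℤ))
    (hT₁ : ∀ t : Fin 2 → ℤ, (∃ k : ℤ,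
        -R₀ - 4 ≤ (L₁ (zigVertexS step₁ k + ((t 0 : ℝ) • triangularVec₁ 1 + (t 1 : ℝ) • triangularVec₂ 1)) + s₁) 2 ∧
        (L₁ (zigVertexS step₁ k + ((t 0 : ℝ) • triangularVec₁ 1 + (t 1 : ℝ) • triangularVec₂ 1)) + s₁) 2 ≤ -R₀ - 3 ∧
        Real.sqrt ((L₁ (zigVertexS step₁ k + ((t 0 : ℝ) • triangularVec₁ 1 + (t 1 : ℝ) • triangularVec₂ 1)) + s₁) 0 ^ 2 +
          (L₁ (zigVertexS step₁ k + ((t 0 : ℝ) • triangularVec₁ 1 + (t 1 : ℝ) • triangularVec₂ 1)) + s₁) 1 ^ 2) ≤ ρ - m) →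
        t ∈ T₁)
    (hT₂ : ∀ t : Fin 2 → ℤ, (∃ k : ℤ,
        h + R₀ + 3 ≤ (L₂ (zigVertexS step₂ k + ((t 0 : ℝ) • triangularVec₁ 1 + (t 1 : ℝ) • triangularVec₂ 1)) + s₂) 2 ∧
        (L₂ (zigVertexS step₂ k + ((t 0 : ℝ) • triangularVec₁ 1 + (t 1 : ℝ) • triangularVec₂ 1)) + s₂) 2 ≤ h + R₀ + 4 ∧
        Real.sqrt ((L₂ (zigVertexS step₂ k + ((t 0 : ℝ) • triangularVec₁ 1 + (t 1 : ℝ) • triangularVec₂ 1)) + s₂) 0 ^ 2 +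
          (L₂ (zigVertexS step₂ k + ((t 0 : ℝ) • triangularVec₁ 1 + (t 1 : ℝ) • triangularVec₂ 1)) + s₂) 1 ^ 2) ≤ ρ - m) →
        t ∈ T₂) :
    2 * ∑' ij : ℤ × ℤ, c ij.1 ij.2 * (volume (wallSlice ρ ∩ laySlab L₁ s₁ ij.1 ∩ laySlab L₂ s₂ ij.2)).toReal ≤
      (T₁.card : ℝ) + T₂.card + 80 * (R₀ + 9) * (1 + h) * ρ + 18 * m * ρ +
        (Real.sqrt 2 / 2 * (4 * Real.pi * ρ * (hB / Real.sqrt ((L₁ e₃) 0 ^ 2 + (L₁ e₃) 1 ^ 2))) +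
          Real.sqrt 2 / 2 * (4 * Real.pi * ρ * (hB / Real.sqrt ((L₂ e₃) 0 ^ 2 + (L₂ e₃) 1 ^ 2)))) := by
  have he₃ : ‖(e₃ : E3)‖ = 1 := by rw [e₃, PiLp.norm_single, norm_one]
  have hne₃ : ‖(-e₃ : E3)‖ = 1 := by rw [norm_neg, he₃]
  have hs2 : 0 ≤ Real.sqrt 2 := Real.sqrt_nonneg 2
  have hκ₁B : ∀ i, ⟪step₁ i, L₁.symm e₃⟫_ℝ ≤ 1 := fun i =>
    (real_inner_le_norm _ _).trans (by rw [(hup₁ i).norm_eq_one, LinearIsometryEquiv.norm_map, he₃, one_mul])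
  have hκ₂B : ∀ j, ⟪step₂ j, L₂.symm (-e₃)⟫_ℝ ≤ 1 := fun j =>
    (real_inner_le_norm _ _).trans (by rw [(hup₂ j).norm_eq_one, LinearIsometryEquiv.norm_map, hne₃, one_mul])
  have hcB : ∀ i j, c i j ≤ Real.sqrt 2 := fun i j => (hdom i j).trans (by
    have h1 : (⟪step₁ i, L₁.symm e₃⟫_ℝ + ⟪step₁ (i + 1), L₁.symm e₃⟫_ℝ) / 2 +
        (⟪step₂ j, L₂.symm (-e₃)⟫_ℝ + ⟪step₂ (j + 1), L₂.symm (-e₃)⟫_ℝ) / 2 ≤ 2 := by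
      linarith [hκ₁B i, hκ₁B (i + 1), hκ₂B j, hκ₂B (j + 1)]
    nlinarith)
  -- the penalty is monotone in the radius
  set pen₁ : ℝ := Real.sqrt 2 / 2 * (4 * Real.pi * (hB / Real.sqrt ((L₁ e₃) 0 ^ 2 + (L₁ e₃) 1 ^ 2))) with hpen₁
  set pen₂ : ℝ := Real.sqrt 2 / 2 * (4 * Real.pi * (hB / Real.sqrt ((L₂ e₃) 0 ^ 2 + (L₂ e₃) 1 ^ 2))) with hpen₂
  have hpen₁0 : 0 ≤ pen₁ := by rw [hpen₁]; have := hB_pos.le; positivity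
  have hpen₂0 : 0 ≤ pen₂ := by rw [hpen₂]; have := hB_pos.le; positivity
  have hpen : ∀ r : ℝ, Real.sqrt 2 / 2 * (4 * Real.pi * r * (hB / Real.sqrt ((L₁ e₃) 0 ^ 2 + (L₁ e₃) 1 ^ 2))) +
      Real.sqrt 2 / 2 * (4 * Real.pi * r * (hB / Real.sqrt ((L₂ e₃) 0 ^ 2 + (L₂ e₃) 1 ^ 2))) = (pen₁ + pen₂) * r := fun r => by
    rw [hpen₁, hpen₂]; ring
  set d : ℝ := 4 * h + 4 * R₀ + 36 with hd
  have hd0 : 0 ≤ d := by rw [hd]; linarith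
  have hRh : 0 ≤ (R₀ + 9) * (1 + h) := mul_nonneg (by linarith) (by linarith)
  have hdle : 18 * d * ρ ≤ 80 * (R₀ + 9) * (1 + h) * ρ := by
    have h1 : 18 * d ≤ 80 * (R₀ + 9) * (1 + h) := by rw [hd]; nlinarith
    nlinarith
  have hN0 : 0 ≤ (T₁.card : ℝ) + T₂.card + (pen₁ + pen₂) * ρ := by positivity
  have hmain := two_charge_wallSlice_le_of_inner L₁ L₂ s₁ s₂ c hc0 hcB (ρ := ρ) (M := m + d)
    (N := (T₁.card : ℝ) + T₂.card + (pen₁ + pen₂) * ρ) hρ (by linarith) hN0 (fun hlt => by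
      have hρ'0 : 0 ≤ ρ - (m + d) := by linarith
      have hin := two_charge_le_lines_inner_up₂_adj hσ₁ hσ₂ L₁ L₂ s₁ s₂ R₀ h (ρ - (m + d)) hR₀ hh hρ'0 hax₁ hax₂ hℓ₁ hℓ₂
        hup₁ hr₁ hup₂ hr₂ c hc0 hdom T₁ T₂
        (fun t ⟨k, hk1, hk2, hk3⟩ => hT₁ t ⟨k, hk1, hk2, hk3.trans (by rw [hd]; linarith)⟩)
        (fun t ⟨k, hk1, hk2, hk3⟩ => hT₂ t ⟨k, hk1, hk2, hk3.trans (by rw [hd]; linarith)⟩)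
      rw [hpen] at hin
      have hmono : (pen₁ + pen₂) * (ρ - (m + d)) ≤ (pen₁ + pen₂) * ρ :=
        mul_le_mul_of_nonneg_left (by linarith) (by linarith)
      linarith)
  rw [hpen]
  linarith

/-! ## The constant: `2√2·π·hB ≤ 15/2` -/

/-- `2√2·π·hB ≤ 15/2` (`hB = √(2/3)`; `2√2·π·√(2/3) = 4π/√3 = 7.255…`). -/
theorem two_sqrt_two_pi_hB_le : 2 * Real.sqrt 2 * Real.pi * hB ≤ 15 / 2 := by
  have hπ := Real.pi_lt_d2
  have hπ0 := Real.pi_pos.le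
  have hs0 : 0 ≤ Real.sqrt 2 := Real.sqrt_nonneg 2
  have hs2 : Real.sqrt 2 ^ 2 = 2 := Real.sq_sqrt (by norm_num)
  have hB0 := hB_pos.le
  have hB2 := hB_sq
  -- `P = √2·hB` has `P² = 4/3`, so `P ≤ 1.155`
  have hP2 : (Real.sqrt 2 * hB) ^ 2 = 4 / 3 := by rw [mul_pow, hs2, hB2]; norm_num
  have hP0 : 0 ≤ Real.sqrt 2 * hB := mul_nonneg hs0 hB0
  have hP : Real.sqrt 2 * hB ≤ 1155 / 1000 := by nlinarith
  have : 2 * Real.sqrt 2 * Real.pi * hB = 2 * Real.pi * (Real.sqrt 2 * hB) := by ring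
  rw [this]
  nlinarith [mul_nonneg hπ0 hP0]

/-- The strip-variation penalty of two plates of tilt `≥ ℓ₀ > 0` is at most `(15/ℓ₀)·(1+h)·ρ`. -/
theorem adj_penalty_le {ℓ₀ ℓ₁ ℓ₂ h ρ : ℝ} (hℓ₀ : 0 < ℓ₀) (h₁ : ℓ₀ ≤ ℓ₁) (h₂ : ℓ₀ ≤ ℓ₂) (hh : 0 ≤ h) (hρ : 0 ≤ ρ) :
    Real.sqrt 2 / 2 * (4 * Real.pi * ρ * (hB / ℓ₁)) + Real.sqrt 2 / 2 * (4 * Real.pi * ρ * (hB / ℓ₂)) ≤ 15 / ℓ₀ * (1 + h) * ρ := by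
  have hB0 := hB_pos.le
  have hs0 : 0 ≤ Real.sqrt 2 := Real.sqrt_nonneg 2
  have hπ0 := Real.pi_pos.le
  have hq₁ : hB / ℓ₁ ≤ hB / ℓ₀ := div_le_div_of_nonneg_left hB0 hℓ₀ h₁
  have hq₂ : hB / ℓ₂ ≤ hB / ℓ₀ := div_le_div_of_nonneg_left hB0 hℓ₀ h₂
  have hA : 0 ≤ Real.sqrt 2 / 2 * (4 * Real.pi * ρ) := by positivity
  have h1 : Real.sqrt 2 / 2 * (4 * Real.pi * ρ * (hB / ℓ₁)) ≤ Real.sqrt 2 / 2 * (4 * Real.pi * ρ) * (hB / ℓ₀) := by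
    rw [show Real.sqrt 2 / 2 * (4 * Real.pi * ρ * (hB / ℓ₁)) = Real.sqrt 2 / 2 * (4 * Real.pi * ρ) * (hB / ℓ₁) by ring]
    exact mul_le_mul_of_nonneg_left hq₁ hA
  have h2 : Real.sqrt 2 / 2 * (4 * Real.pi * ρ * (hB / ℓ₂)) ≤ Real.sqrt 2 / 2 * (4 * Real.pi * ρ) * (hB / ℓ₀) := by
    rw [show Real.sqrt 2 / 2 * (4 * Real.pi * ρ * (hB / ℓ₂)) = Real.sqrt 2 / 2 * (4 * Real.pi * ρ) * (hB / ℓ₂) by ring]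
    exact mul_le_mul_of_nonneg_left hq₂ hA
  have hK := two_sqrt_two_pi_hB_le
  -- `2 · (√2/2·4πρ·hB/ℓ₀) = (2√2·π·hB)·(2ρ/ℓ₀) ≤ (15/2)(2ρ/ℓ₀) = 15ρ/ℓ₀ ≤ (15/ℓ₀)(1+h)ρ`
  have h3 : 2 * (Real.sqrt 2 / 2 * (4 * Real.pi * ρ) * (hB / ℓ₀)) = (2 * Real.sqrt 2 * Real.pi * hB) * (2 * ρ / ℓ₀) := by
    field_simp
    ring
  have hρℓ : 0 ≤ 2 * ρ / ℓ₀ := by positivity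
  have h4 : (2 * Real.sqrt 2 * Real.pi * hB) * (2 * ρ / ℓ₀) ≤ 15 / 2 * (2 * ρ / ℓ₀) := mul_le_mul_of_nonneg_right hK hρℓ
  have h5 : 15 / 2 * (2 * ρ / ℓ₀) = 15 / ℓ₀ * ρ := by field_simp
  have h6 : 15 / ℓ₀ * ρ ≤ 15 / ℓ₀ * (1 + h) * ρ := by
    have h15 : 0 ≤ 15 / ℓ₀ * ρ := by positivity
    nlinarith
  linarith

/-! ## The two-sided steered deliverable shape ⇒ the covered cell, adjacent-mean tables -/

/-- **`T1_adj` — two-family line count along chosen steps ⇒ the covered cell inequality for ADJACENT-MEAN-dominated tables** on the class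
`0 < ℓ₀ ≤ sin β₁, sin β₂` (`sin βᵢ = √((Lᵢ e₃)₀² + (Lᵢ e₃)₁²)`).  Same line-count shape `hF` as `bilayerWallAt_of_lineCount_up₂` (the G3 deliverable of
`barlow_hlines_oriented_apart_at_tiltWide`); table domination `c i j ≤ √2·(½(r₁ i + r₁(i+1)) + ½(r₂ j + r₂(j+1)))/2`; conclusion
`BilayerWallAt ((C_w + 80(R₀+9) + 15/ℓ₀ + 3456 + 1152(R₀+1))/2) R₀ σ₁ σ₂ L₁ L₂ s₁ s₂ c` (`R₀ ≥ 3`). -/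
theorem bilayerWallAt_of_lineCount_up₂_adj {σ₁ σ₂ : ℤ → ℤ} (hσ₁ : IsHaggSeq σ₁) (hσ₂ : IsHaggSeq σ₂)
    (L₁ L₂ : E3 ≃ₗᵢ[ℝ] E3) (s₁ s₂ : E3) (R₀ C_w : ℝ) (hR₀ : 3 ≤ R₀)
    (hax₁ : 0 ≤ (L₁.symm e₃) 2) (hax₂ : 0 ≤ (L₂.symm (-e₃)) 2)
    {ℓ₀ : ℝ} (hℓ₀ : 0 < ℓ₀) (hℓ₁ : ℓ₀ ≤ Real.sqrt ((L₁ e₃) 0 ^ 2 + (L₁ e₃) 1 ^ 2))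
    (hℓ₂ : ℓ₀ ≤ Real.sqrt ((L₂ e₃) 0 ^ 2 + (L₂ e₃) 1 ^ 2))
    {step₁ : ℤ → E3} (hup₁ : ∀ k : ℤ, IsUpBond L₁ σ₁ e₃ k (step₁ k)) (hr₁ : ∀ k : ℤ, (1 / 4 : ℝ) ≤ ⟪step₁ k, L₁.symm e₃⟫_ℝ)
    {step₂ : ℤ → E3} (hup₂ : ∀ k : ℤ, IsUpBond L₂ σ₂ (-e₃) k (step₂ k)) (hr₂ : ∀ k : ℤ, (1 / 4 : ℝ) ≤ ⟪step₂ k, L₂.symm (-e₃)⟫_ℝ)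
    (c : ℤ → ℤ → ℝ) (hc0 : ∀ i j, 0 ≤ c i j)
    (hdom : ∀ i j, c i j ≤ Real.sqrt 2 * ((⟪step₁ i, L₁.symm e₃⟫_ℝ + ⟪step₁ (i + 1), L₁.symm e₃⟫_ℝ) / 2 +
      (⟪step₂ j, L₂.symm (-e₃)⟫_ℝ + ⟪step₂ (j + 1), L₂.symm (-e₃)⟫_ℝ) / 2) / 2)
    (hF : ∀ h : ℝ, 0 ≤ h → ∀ ρ : ℝ, R₀ ≤ ρ → ∀ X P₁ P₂ : Finset E3,
      (∀ p ∈ X, ∀ q ∈ X, p ≠ q → 1 ≤ dist p q) → P₁ ⊆ X → P₂ ⊆ X \ P₁ → (∀ p ∈ X, p ∈ cyl R₀ h ρ) →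
      (∀ p, p ∈ P₁ ↔ (p ∈ stacking L₁ s₁ σ₁ ∧ -(2 * R₀) ≤ p 2 ∧ p 2 ≤ -R₀ ∧ p 0 ^ 2 + p 1 ^ 2 ≤ ρ ^ 2)) →
      (∀ p, p ∈ P₂ ↔ (p ∈ stacking L₂ s₂ σ₂ ∧ h + R₀ ≤ p 2 ∧ p 2 ≤ h + 2 * R₀ ∧ p 0 ^ 2 + p 1 ^ 2 ≤ ρ ^ 2)) →
      ∃ (m : ℝ) (T₁ T₂ : Finset (Fin 2 → ℤ)), 0 ≤ m ∧
        (∀ t : Fin 2 → ℤ, (∃ k : ℤ,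
          -R₀ - 4 ≤ (L₁ (zigVertexS step₁ k + ((t 0 : ℝ) • triangularVec₁ 1 + (t 1 : ℝ) • triangularVec₂ 1)) + s₁) 2 ∧
          (L₁ (zigVertexS step₁ k + ((t 0 : ℝ) • triangularVec₁ 1 + (t 1 : ℝ) • triangularVec₂ 1)) + s₁) 2 ≤ -R₀ - 3 ∧
          Real.sqrt ((L₁ (zigVertexS step₁ k + ((t 0 : ℝ) • triangularVec₁ 1 + (t 1 : ℝ) • triangularVec₂ 1)) + s₁) 0 ^ 2 +
            (L₁ (zigVertexS step₁ k + ((t 0 : ℝ) • triangularVec₁ 1 + (t 1 : ℝ) • triangularVec₂ 1)) + s₁) 1 ^ 2) ≤ ρ - m) →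
          t ∈ T₁) ∧
        (∀ t : Fin 2 → ℤ, (∃ k : ℤ,
          h + R₀ + 3 ≤ (L₂ (zigVertexS step₂ k + ((t 0 : ℝ) • triangularVec₁ 1 + (t 1 : ℝ) • triangularVec₂ 1)) + s₂) 2 ∧
          (L₂ (zigVertexS step₂ k + ((t 0 : ℝ) • triangularVec₁ 1 + (t 1 : ℝ) • triangularVec₂ 1)) + s₂) 2 ≤ h + R₀ + 4 ∧
          Real.sqrt ((L₂ (zigVertexS step₂ k + ((t 0 : ℝ) • triangularVec₁ 1 + (t 1 : ℝ) • triangularVec₂ 1)) + s₂) 0 ^ 2 +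
            (L₂ (zigVertexS step₂ k + ((t 0 : ℝ) • triangularVec₁ 1 + (t 1 : ℝ) • triangularVec₂ 1)) + s₂) 1 ^ 2) ≤ ρ - m) →
          t ∈ T₂) ∧
        (T₁.card : ℝ) + T₂.card + 18 * m * ρ ≤
          (∑ y ∈ X.filter (fun y => (X.filter fun q => dist y q = 1).card ≠ 12 ∧ -R₀ - 2 ≤ y 2 ∧ y 2 ≤ h + R₀ + 2),
            ((12 : ℝ) - ((X.filter fun q => dist y q = 1).card : ℝ))) + C_w * (1 + h) * ρ) :
    BilayerWallAt ((C_w + 80 * (R₀ + 9) + 15 / ℓ₀ + 3456 + 1152 * (R₀ + 1)) / 2) R₀ σ₁ σ₂ L₁ L₂ s₁ s₂ c := by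
  classical
  have hR₀1 : 1 ≤ R₀ := by linarith
  have hℓ₁' : 0 < (L₁ e₃) 0 ^ 2 + (L₁ e₃) 1 ^ 2 := by
    by_contra hneg
    have h0 : (L₁ e₃) 0 ^ 2 + (L₁ e₃) 1 ^ 2 = 0 := le_antisymm (not_lt.1 hneg) (by positivity)
    rw [h0, Real.sqrt_zero] at hℓ₁
    linarith
  have hℓ₂' : 0 < (L₂ e₃) 0 ^ 2 + (L₂ e₃) 1 ^ 2 := by
    by_contra hneg
    have h0 : (L₂ e₃) 0 ^ 2 + (L₂ e₃) 1 ^ 2 = 0 := le_antisymm (not_lt.1 hneg) (by positivity)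
    rw [h0, Real.sqrt_zero] at hℓ₂
    linarith
  refine bilayerWallAt_of_payerBound hσ₁ hσ₂ L₁ L₂ s₁ s₂ R₀ (C_w + 80 * (R₀ + 9) + 15 / ℓ₀) hR₀ c ?_
  intro h hh ρ hρ X P₁ P₂ hX hP₁X hP₂X hcell hP₁ hP₂
  obtain ⟨m, T₁, T₂, hm, hT₁, hT₂, hcount⟩ := hF h hh ρ hρ X P₁ P₂ hX hP₁X hP₂X hcell hP₁ hP₂
  have hρ0 : 0 ≤ ρ := by linarith
  have hcellbound := cell_charge_le_lines_margin_up₂_adj hσ₁ hσ₂ L₁ L₂ s₁ s₂ R₀ h ρ hR₀1 hh hρ0 hax₁ hax₂ hℓ₁' hℓ₂' hup₁ hr₁ hup₂ hr₂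
    c hc0 hdom m hm T₁ T₂ hT₁ hT₂
  have hpen := adj_penalty_le hℓ₀ hℓ₁ hℓ₂ hh hρ0
  have hset : ({q : E3 | 0 ≤ q 2 ∧ q 2 ≤ 1 ∧ q 0 ^ 2 + q 1 ^ 2 ≤ ρ ^ 2} : Set E3) = wallSlice ρ := rfl
  rw [hset]
  have hsplit : (C_w + 80 * (R₀ + 9) + 15 / ℓ₀) * (1 + h) * ρ =
      C_w * (1 + h) * ρ + 80 * (R₀ + 9) * (1 + h) * ρ + 15 / ℓ₀ * (1 + h) * ρ := by ring
  rw [hsplit]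
  linarith

end Summit.Ventures.Crystal3D.Theorems

end
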